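import Literature.MathematicalPhysics.QuantumLattice.ForwardTubeTwoPoint
import Literature.MathematicalPhysics.QuantumLattice.WightmanBHWTransport
import Literature.MathematicalPhysics.QuantumLattice.TubeBoundaryValueLocal
import Literature.MathematicalPhysics.QuantumFieldTheory.OSLorentzInvariance
import HarnessLib

/-!
# Transport of covariance laws from boundary values into the tube; relativization of tube functions

Topic `Literature/MathematicalPhysics/QuantumLattice` (trunk T-AQFT). Generic complements to
`WightmanTubeInvariance` / `ForwardTubeTwoPoint` for *vector-valued* (multiplet) tube functions, as
needed for the Wightman functions of spinor multiplets (Streater–Wightman (1964), Thm. 3-5 with the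
transformation law (3-42)–(3-44): "`𝒲_{μ…ν}(Λz₁, …, Λzₙ) = ∑ S(A⁻¹) ⋯ 𝒲(z₁, …, zₙ)`"), in the
proof of the PCT theorem (§4-3, Thm. 4-7):

* `eq_zero_on_relForwardTube_of_rayBV_zero` — **weak uniqueness on the relative tube**: a function
  holomorphic on `𝒯ʳₙ` whose ray boundary values vanish on all *compactly supported* test functions
  vanishes on `𝒯ʳₙ` (S–W Thm. 2-17 in the local form `eq_zero_of_rayBoundaryValue_zero_of_isOpen`,
  then the identity theorem on the convex `𝒯ʳₙ`). Compact support makes finite linear combinations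
  of boundary values harmless (all ray integrands are integrable).
* `apply_lorentz_eq_sum_of_bv` — **a covariance law of the boundary values is a covariance law of
  the tube function**: if `F : 𝒯ʳₙ → (ι → ℂ)` is holomorphic with boundary values `T_a` and
  `T_a ∘ (0, Λ) = ∑_b N_{ab} T_b` for a restricted Lorentz transformation `Λ`, then
  `F(Λz)_a = ∑_b N_{ab} F(z)_b` on `𝒯ʳₙ`.
* `relativize F z = F(z − z₀ + i e₀)` — **from the forward tube to the relative tube**: for `F`
  holomorphic on `𝒯ₙ` and invariant under real common translations (e.g. the tube function of a
  translation-invariant distribution, `eqOn_add_real_of_bv`), `relativize F` is holomorphic on `𝒯ʳₙ`,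
  invariant under *all* complex common translations, equal to `F` on `𝒯ₙ` (complex translations from
  real ones, `apply_add_const_eq_of_forall_add_real_eq`), and has the same boundary values — the
  function "`W` of the differences" of S–W Thm. 3-5 written in absolute variables.
* `TubeBoost.boost_ofReal_eq_lorentzActC` — the light-cone boost of `TubeBoostReflection` at real
  rapidity is the complexified action of the Lorentz boost `boost 2 χ` in the third direction.

## References

* R. F. Streater, A. S. Wightman, *PCT, Spin and Statistics, and All That* (1964; Princeton 2000),
  Thm. 2-17, Thm. 3-5 and eqs. (3-42)–(3-44). [StreaterWightman1964]
-/

noncomputable section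

open Complex Set Filter MeasureTheory
open _root_.Topology
open scoped SchwartzMap

namespace Literature.MathematicalPhysics.QuantumLattice

variable {d n : ℕ}

/-! ### Weak uniqueness on the relative tube -/

/-- **Weak uniqueness on `𝒯ʳₙ`**: a function holomorphic on the relative tube whose ray boundary
values vanish on every compactly supported test function vanishes on `𝒯ʳₙ`.
[cite: StreaterWightman1964, Thm 2-17] -/
theorem eq_zero_on_relForwardTube_of_rayBV_zero {G : (Fin n → Fin (d + 1) → ℂ) → ℂ}
    (hG : DifferentiableOn ℂ G (QuantumFieldTheory.relForwardTube d n))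
    (hlim : ∀ η ∈ tubeCone d n, ∀ F : 𝓢((Fin n → SpaceTime d), ℂ),
      HasCompactSupport (F : (Fin n → SpaceTime d) → ℂ) →
      Tendsto (fun t : ℝ => ∫ x : Fin n → SpaceTime d,
        G (fun k => complexifyPoint (x k) + ((t : ℂ) * I) • complexifyPoint (η k)) * F x)
        (𝓝[>] 0) (𝓝 0))
    {z : Fin n → Fin (d + 1) → ℂ} (hz : z ∈ QuantumFieldTheory.relForwardTube d n) : G z = 0 := by
  -- zero on the forward tube
  have hfwd : ∀ w ∈ forwardTube d n, G w = 0 := fun w hw =>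
    eq_zero_of_rayBoundaryValue_zero_of_isOpen (hG.mono QuantumFieldTheory.forwardTube_subset_relForwardTube)
      isOpen_univ univ_nonempty (fun η hη F hF _ => hlim η hη F hF) hw
  -- identity theorem on the convex relative tube
  obtain ⟨z₀, hz₀⟩ := (forwardTube_nonempty (d := d) (n := n))
  have hGan : AnalyticOnNhd ℂ G (QuantumFieldTheory.relForwardTube d n) :=
    Literature.Analysis.Complex.SCV.analyticOnNhd_of_differentiableOn hG isOpen_relForwardTube
  have hev : G =ᶠ[𝓝 z₀] 0 := by
    filter_upwards [isOpen_forwardTube.mem_nhds hz₀] with w hw using hfwd w hw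
  exact hGan.eqOn_zero_of_preconnected_of_eventuallyEq_zero convex_relForwardTube.isPreconnected
    (QuantumFieldTheory.forwardTube_subset_relForwardTube hz₀) hev hz

/-- Rays from real points in base-cone directions lie in `𝒯ₙ ⊆ 𝒯ʳₙ`; a function holomorphic on `𝒯ʳₙ`
is continuous along each ray slice `x ↦ G(x + itη)`. [folklore] -/
theorem continuous_raySlice {E : Type*} [NormedAddCommGroup E] [NormedSpace ℂ E]
    {G : (Fin n → Fin (d + 1) → ℂ) → E} (hG : DifferentiableOn ℂ G (QuantumFieldTheory.relForwardTube d n))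
    {η : Fin n → SpaceTime d} (hη : η ∈ tubeCone d n) {t : ℝ} (ht : 0 < t) :
    Continuous fun x : Fin n → SpaceTime d =>
      G (fun k => complexifyPoint (x k) + ((t : ℂ) * I) • complexifyPoint (η k)) := by
  have hr : Continuous fun x : Fin n → SpaceTime d =>
      (fun k => complexifyPoint (x k) + ((t : ℂ) * I) • complexifyPoint (η k)) :=
    continuous_pi fun k => (continuous_complexifyPoint.comp (continuous_apply k)).add continuous_const
  exact hG.continuousOn.comp_continuous hr fun x =>
    QuantumFieldTheory.forwardTube_subset_relForwardTube (mem_forwardTube_of_mem_tubeCone x η hη ht)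

/-! ### Covariance laws from boundary values -/

section Transport

variable {ι : Type*} [Fintype ι]

/-- **A covariance law of the boundary values is a covariance law of the tube function**
(Streater–Wightman (1964), Thm. 3-5 with (3-42)–(3-44), for multiplets): if `F` is holomorphic on
`𝒯ʳₙ` with values in `ι → ℂ`, component `a` having the boundary value `T a`, and for a restricted
Lorentz transformation `Λ` the boundary values satisfy `T_a ∘ (0, Λ) = ∑_b N_{ab} T_b`, then
`F(Λ z)_a = ∑_b N_{ab} F(z)_b` for `z ∈ 𝒯ʳₙ`. [cite: StreaterWightman1964, Thm 3-5] -/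
theorem apply_lorentz_eq_sum_of_bv {F : (Fin n → Fin (d + 1) → ℂ) → ι → ℂ}
    (hF : DifferentiableOn ℂ F (QuantumFieldTheory.relForwardTube d n))
    {T : ι → (𝓢((Fin n → SpaceTime d), ℂ) →L[ℂ] ℂ)}
    (hbv : ∀ a, HasDistributionalBoundaryValue (fun z => F z a) (T a))
    (Λ : restrictedLorentzGroup d) (N : ι → ι → ℂ)
    (hT : ∀ a, (T a).comp (poincareTestMulti n (SemidirectProduct.inr Λ)) = ∑ b, N a b • T b)
    {z : Fin n → Fin (d + 1) → ℂ} (hz : z ∈ QuantumFieldTheory.relForwardTube d n) (a : ι) :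
    F (fun k => lorentzActC (Λ : SpaceTime d ≃L[ℝ] SpaceTime d) (z k)) a = ∑ b, N a b * F z b := by
  set G : (Fin n → Fin (d + 1) → ℂ) → ℂ := fun z =>
    F (fun k => lorentzActC (Λ : SpaceTime d ≃L[ℝ] SpaceTime d) (z k)) a - ∑ b, N a b * F z b with hGdef
  -- holomorphy of the pieces
  have hFa : ∀ b, DifferentiableOn ℂ (fun z => F z b) (QuantumFieldTheory.relForwardTube d n) := fun b z hz =>
    (ContinuousLinearMap.proj b : (ι → ℂ) →L[ℂ] ℂ).differentiableAt.comp_differentiableWithinAt z (hF z hz)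
  have hFΛ : DifferentiableOn ℂ
      (fun z => F (fun k => lorentzActC (Λ : SpaceTime d ≃L[ℝ] SpaceTime d) (z k)) a)
      (QuantumFieldTheory.relForwardTube d n) :=
    (hFa a).comp (QuantumFieldTheory.differentiable_lorentzActC_diag _).differentiableOn
      fun w hw => lorentzActC_mem_relForwardTube Λ hw
  have hGd : DifferentiableOn ℂ G (QuantumFieldTheory.relForwardTube d n) :=
    hFΛ.sub (DifferentiableOn.fun_sum fun b _ => (hFa b).const_mul _)
  have key := eq_zero_on_relForwardTube_of_rayBV_zero hGd ?_ hz
  · simpa [hGdef, sub_eq_zero] using key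
  -- the ray boundary values of `G` vanish
  intro η hη φ hφ
  have h1 := (hbv a).comp_lorentz Λ η hη φ
  rw [hT a] at h1
  have h2 : ∀ b, Tendsto (fun t : ℝ => ∫ x : Fin n → SpaceTime d,
      F (fun k => complexifyPoint (x k) + ((t : ℂ) * I) • complexifyPoint (η k)) b * φ x)
      (𝓝[>] 0) (𝓝 (T b φ)) := fun b => hbv b η hη φ
  have hsum : Tendsto (fun t : ℝ => ∑ b, N a b * ∫ x : Fin n → SpaceTime d,
      F (fun k => complexifyPoint (x k) + ((t : ℂ) * I) • complexifyPoint (η k)) b * φ x)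
      (𝓝[>] 0) (𝓝 (∑ b, N a b * T b φ)) :=
    tendsto_finsetSum _ fun b _ => (h2 b).const_mul _
  have htot := h1.sub hsum
  have hval : (∑ b, N a b • T b) φ - ∑ b, N a b * T b φ = 0 := by simp
  rw [hval] at htot
  refine htot.congr' ?_
  filter_upwards [self_mem_nhdsWithin] with t ht
  have hiΛ : Integrable fun x : Fin n → SpaceTime d =>
      F (fun k => lorentzActC (Λ : SpaceTime d ≃L[ℝ] SpaceTime d)
        (complexifyPoint (x k) + ((t : ℂ) * I) • complexifyPoint (η k))) a * φ x :=
    ((continuous_raySlice hFΛ hη ht).mul φ.continuous).integrable_of_hasCompactSupport hφ.mul_left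
  have hib : ∀ b, Integrable fun x : Fin n → SpaceTime d =>
      F (fun k => complexifyPoint (x k) + ((t : ℂ) * I) • complexifyPoint (η k)) b * φ x := fun b =>
    ((continuous_raySlice (hFa b) hη ht).mul φ.continuous).integrable_of_hasCompactSupport hφ.mul_left
  have e : ∀ b, N a b * ∫ x : Fin n → SpaceTime d,
      F (fun k => complexifyPoint (x k) + ((t : ℂ) * I) • complexifyPoint (η k)) b * φ x =
      ∫ x : Fin n → SpaceTime d, N a b * (F (fun k => complexifyPoint (x k) + ((t : ℂ) * I) • complexifyPoint (η k)) b * φ x) :=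
    fun b => (integral_const_mul _ _).symm
  simp_rw [e]
  rw [← integral_finsetSum _ (fun b _ => (hib b).const_mul _), ← integral_sub hiΛ
    (integrable_finsetSum _ fun b _ => (hib b).const_mul _)]
  refine integral_congr_ae (Eventually.of_forall fun x => ?_)
  simp only [hGdef, sub_mul, Finset.sum_mul]
  congr 1
  refine Finset.sum_congr rfl fun b _ => ?_
  ring

/-- **Real translation invariance of the boundary values gives real translation invariance of the
tube function** on `𝒯ₙ`. [cite: StreaterWightman1964, Thm 3-5] -/
theorem eqOn_add_real_of_bv {F : (Fin n → Fin (d + 1) → ℂ) → ℂ} (hF : DifferentiableOn ℂ F (forwardTube d n))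
    {T : 𝓢((Fin n → SpaceTime d), ℂ) →L[ℂ] ℂ} (hbv : HasDistributionalBoundaryValue F T)
    (hT : ∀ a : SpaceTime d, T.comp (poincareTestMulti n (SemidirectProduct.inl (Multiplicative.ofAdd a))) = T)
    (a : SpaceTime d) {z : Fin n → Fin (d + 1) → ℂ} (hz : z ∈ forwardTube d n) :
    F (fun k => z k + complexifyPoint a) = F z := by
  have hd : DifferentiableOn ℂ (fun z : Fin n → Fin (d + 1) → ℂ => F (fun i => z i + complexifyPoint a))
      (forwardTube d n) := by
    refine hF.comp ?_ fun w hw => add_complexifyPoint_mem_forwardTube hw _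
    exact (differentiable_pi.2 fun i => (differentiable_apply i).add (differentiable_const _)).differentiableOn
  have hb := hbv.comp_add_real a
  rw [hT a] at hb
  exact eqOn_forwardTube_of_hasDistributionalBoundaryValue hd hF hb hbv hz

end Transport

/-! ### From the forward tube to the relative tube -/

section Relativize

variable {E : Type*} [NormedAddCommGroup E] [NormedSpace ℂ E]

/-- The first point of a configuration (`0` for the empty configuration). [folklore] -/
def firstPt (z : Fin n → Fin (d + 1) → ℂ) : Fin (d + 1) → ℂ :=
  if h : 0 < n then z ⟨0, h⟩ else 0

/-- The **normalising shift** `z ↦ z − z₀ + i e₀` (common complex translation taking the first point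
to the base point `i e₀` of the tube). [folklore] -/
def shiftToBase (z : Fin n → Fin (d + 1) → ℂ) : Fin n → Fin (d + 1) → ℂ := fun k => z k + (basePt d - firstPt z)

/-- The shift is a common translation. [folklore] -/
theorem shiftToBase_eq (z : Fin n → Fin (d + 1) → ℂ) : shiftToBase z = fun k => z k + (basePt d - firstPt z) := rfl

/-- **The shift maps `𝒯ʳₙ` into `𝒯ₙ`** (the first point becomes `i e₀`, the differences are unchanged).
[folklore] -/
theorem shiftToBase_mem_forwardTube {z : Fin n → Fin (d + 1) → ℂ} (hz : z ∈ QuantumFieldTheory.relForwardTube d n) :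
    shiftToBase z ∈ forwardTube d n := by
  cases n with
  | zero => exact fun k => k.elim0
  | succ m =>
    intro k
    refine Fin.cases ?_ (fun j => ?_) k
    · rw [succDiff_zero]
      simp only [shiftToBase, firstPt, Nat.zero_lt_succ, ↓reduceDIte, Fin.mk_zero, add_sub_cancel]
      rw [imPart_basePt]
      exact e₀_mem_forwardCone
    · rw [succDiff_succ]
      have h := (mem_relForwardTube_succ_iff z).1 hz j
      simpa [shiftToBase] using h

/-- The shift is invariant under common complex translations. [folklore] -/
theorem shiftToBase_add_const (z : Fin n → Fin (d + 1) → ℂ) (c : Fin (d + 1) → ℂ) :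
    shiftToBase (fun k => z k + c) = shiftToBase z := by
  cases n with
  | zero => funext k; exact k.elim0
  | succ m =>
    funext k
    simp only [shiftToBase, firstPt, Nat.zero_lt_succ, ↓reduceDIte]
    ring

/-- The shift is differentiable. [folklore] -/
theorem differentiable_shiftToBase : Differentiable ℂ (shiftToBase (d := d) (n := n)) := by
  refine differentiable_pi.2 fun k => (differentiable_apply k).add ((differentiable_const _).sub ?_)
  unfold firstPt
  split_ifs
  · exact differentiable_apply _
  · exact differentiable_const _

/-- **Relativization** of a function on the forward tube: `relativize F z = F(z − z₀ + i e₀)`.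
[cite: StreaterWightman1964, Thm 3-5] -/
def relativize (F : (Fin n → Fin (d + 1) → ℂ) → E) (z : Fin n → Fin (d + 1) → ℂ) : E := F (shiftToBase z)

/-- The relativized function is holomorphic on `𝒯ʳₙ`. [folklore] -/
theorem differentiableOn_relativize {F : (Fin n → Fin (d + 1) → ℂ) → E} (hF : DifferentiableOn ℂ F (forwardTube d n)) :
    DifferentiableOn ℂ (relativize F) (QuantumFieldTheory.relForwardTube d n) :=
  hF.comp differentiable_shiftToBase.differentiableOn fun _ hz => shiftToBase_mem_forwardTube hz

omit [NormedAddCommGroup E] [NormedSpace ℂ E] in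
/-- **The relativized function is invariant under all common complex translations.** [folklore] -/
theorem relativize_add_const (F : (Fin n → Fin (d + 1) → ℂ) → E) (z : Fin n → Fin (d + 1) → ℂ)
    (c : Fin (d + 1) → ℂ) : relativize F (fun k => z k + c) = relativize F z := by
  simp only [relativize, shiftToBase_add_const]

/-- **On `𝒯ₙ` the relativized function is the original one**, provided `F` is invariant under real
common translations (complex translations from real ones, `apply_add_const_eq_of_forall_add_real_eq`).
[cite: StreaterWightman1964, Thm 3-5] -/
theorem relativize_eq_self {F : (Fin n → Fin (d + 1) → ℂ) → ℂ} (hF : DifferentiableOn ℂ F (forwardTube d n))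
    (hreal : ∀ (a : SpaceTime d), ∀ z ∈ forwardTube d n, F (fun k => z k + complexifyPoint a) = F z)
    {z : Fin n → Fin (d + 1) → ℂ} (hz : z ∈ forwardTube d n) : relativize F z = F z :=
  apply_add_const_eq_of_forall_add_real_eq hF hreal hz
    (shiftToBase_mem_forwardTube (QuantumFieldTheory.forwardTube_subset_relForwardTube hz))

/-- The relativized function has the same boundary values. [folklore] -/
theorem HasDistributionalBoundaryValue.relativize {F : (Fin n → Fin (d + 1) → ℂ) → ℂ}
    {T : 𝓢((Fin n → SpaceTime d), ℂ) →L[ℂ] ℂ} (hbv : HasDistributionalBoundaryValue F T)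
    (hF : DifferentiableOn ℂ F (forwardTube d n))
    (hreal : ∀ (a : SpaceTime d), ∀ z ∈ forwardTube d n, F (fun k => z k + complexifyPoint a) = F z) :
    HasDistributionalBoundaryValue (relativize F) T :=
  hbv.congr_of_eqOn_forwardTube fun _ hz => relativize_eq_self hF hreal hz

/-- Vector-valued version: componentwise agreement on `𝒯ₙ`. [folklore] -/
theorem relativize_apply_eq_self {ι : Type*} {F : (Fin n → Fin (d + 1) → ℂ) → ι → ℂ}
    (hF : ∀ a, DifferentiableOn ℂ (fun z => F z a) (forwardTube d n))
    (hreal : ∀ a, ∀ (x : SpaceTime d), ∀ z ∈ forwardTube d n, F (fun k => z k + complexifyPoint x) a = F z a)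
    {z : Fin n → Fin (d + 1) → ℂ} (hz : z ∈ forwardTube d n) : relativize F z = F z := by
  funext a
  exact relativize_eq_self (F := fun z => F z a) (hF a) (hreal a) hz

end Relativize

/-! ### The light-cone boost at real rapidity is a Lorentz boost -/

/-- The light-cone boost of `TubeBoostReflection` is the coordinate complex boost `boostC 2` in the
third spatial direction. [folklore] -/
theorem TubeBoost.boost_eq_boostC (w : ℂ) (ζ : Fin (3 + 1) → ℂ) :
    TubeBoost.boost w ζ = QuantumFieldTheory.boostC 2 w ζ := by
  funext μ
  simp only [TubeBoost.boost, TubeBoost.lcU, TubeBoost.lcV, QuantumFieldTheory.boostC, Complex.cosh, Complex.sinh]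
  have h3 : (Fin.succ (2 : Fin 3) : Fin (3 + 1)) = 3 := rfl
  simp only [h3]
  split_ifs with h0 h3'
  · subst h0; ring
  · subst h3'; ring
  · rfl

/-- **At real rapidity the light-cone boost is the complexified Lorentz boost** `Λ_ℂ(B₃(χ))`.
[cite: StreaterWightman1964, §2-4] -/
theorem TubeBoost.boost_ofReal_eq_lorentzActC (χ : ℝ) (ζ : Fin (3 + 1) → ℂ) :
    TubeBoost.boost (χ : ℂ) ζ = lorentzActC (QuantumLattice.boost 2 χ) ζ := by
  rw [TubeBoost.boost_eq_boostC, QuantumFieldTheory.boostC_ofReal]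

end Literature.MathematicalPhysics.QuantumLattice
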